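import Summits.NavierStokesRegularity.NavierStokesRegularity.Theses.AxisymmetricExtremality
import Literature.Analysis.FluidPDE.AxisymNoSwirlLocalMaxPrinciple
import Literature.Analysis.FluidPDE.AncientMildWeakStar
import HarnessLib

/-!
# Seregin 2020, proof of Thm 2.1, the no-swirl endgame core: the bound for `η = ω_θ/ϱ` on the
# parabolic boundary of a cylinder reaching the top time

Helper toward the stub `stub_seregin2020TypeII` of the crux `AxisymmetricKatoGlobal` (= the named
fact `Literature.Analysis.FluidPDE.Seregin2020_axisymmetricSingularPoint_typeII`, G. Seregin,
Anal. Math. Phys. 10 (2020) Paper 46 = arXiv:2006.04140, Thm 2.1), last paragraph of the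
printed proof (arXiv p. 8): the swirl-free axisymmetric suitable weak solution is smooth "by
considering a problem for `η = ω_φ/ϱ`". In the tree this is the local maximum principle
`Literature.Analysis.FluidPDE.noSwirl_abs_scalar_le_of_boundary` for the scalar
`f = hadamardQuotFst ((curl W ·) ·)₁ = ω_θ/ϱ` of a globally smooth, axisymmetric, swirl-free
family `W τ`, `τ` in a time interval, whose two boundary hypotheses are a bound `|f| ≤ M` on the
bottom `{t₀} × B̄(c, R)` and on the lateral boundary `[t₀, t₁] × ∂B(c, R)`. At a clean first
singular configuration the cylinder reaches the (possibly singular) top time `T`, and the bound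
must be UNIFORM in `t₁ < T`. This file proves exactly that uniform boundary bound
(`noSwirl_scalar_boundary_bound`) from

* the regularity of the family on `[t₀, T)` (smooth slices with uniform-in-`x` time moduli of
  all derivatives — the standing hypotheses of the maximum principle, which give the joint
  continuity of `f`), and
* local bounds for `curl W` and `D(curl W)₁` near every point of the top rim `{T} × ∂B(c, R)`
  up to the top time (in the application: backward boundedness of the solution at the rim
  points, which are regular, and the higher interior regularity of bounded solutions),

by compactness of the rim: near a rim point ON the axis `|f| ≤ sup ‖D(curl W)₁‖` over meridian
segments, which stay in the small ball (`abs_scalar_le_of_segment`); near a rim point OFF the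
axis `|f| = ‖curl W‖/ϱ` with `ϱ` bounded below (`abs_scalar_eq_norm_curl_div`); below the
resulting time window the lateral boundary is compact inside the regularity region.

## References

* G. Seregin, Anal. Math. Phys. 10 (2020), Paper 46 = arXiv:2006.04140, proof of Thm. 2.1, last
  paragraph (arXiv p. 8). [Seregin2020]
* G. Koch, N. Nadirashvili, G. Seregin, V. Šverák, Acta Math. 203 (2009) 83–105, §5 p. 9 (the
  equation and maximum principle for `ω_φ/ϱ` in the lifted variables).
  [KochNadirashviliSereginSverak2009]
-/

-- the problem directory repeats the summit name (D-0017); core's `dupNamespace` linter fires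
set_option linter.dupNamespace false

noncomputable section

open MeasureTheory Set Function Filter Topology TopologicalSpace Metric
open scoped NNReal ENNReal ContDiff

namespace Summit.NavierStokesRegularity.NavierStokesRegularity.Theorems.AxisymmetricKatoGlobal.EulerScaling

open Literature.Analysis.FluidPDE

/-! ### Two geometric facts about axis points -/

/-- Scaling the first coordinate by `σ ∈ [0, 1]` does not increase the distance to a point of
the axis. [folklore] -/
theorem dist_scaleFst_le_of_axis {c : EuclideanSpace ℝ (Fin 3)} (hc : c 0 = 0 ∧ c 1 = 0)
    {σ : ℝ} (hσ : σ ∈ Icc (0 : ℝ) 1) (p : EuclideanSpace ℝ (Fin 3)) :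
    dist (scaleFst σ p) c ≤ dist p c := by
  rw [EuclideanSpace.dist_eq, EuclideanSpace.dist_eq]
  refine Real.sqrt_le_sqrt ?_
  simp only [Fin.sum_univ_three, Real.dist_eq, sq_abs, scaleFst_apply_zero, scaleFst_apply_one,
    scaleFst_apply_two, hc.1, hc.2, sub_zero]
  have h1 : σ ^ 2 ≤ 1 := by
    have := hσ.1
    have := hσ.2
    nlinarith
  nlinarith [sq_nonneg (p 0), mul_le_mul_of_nonneg_right h1 (sq_nonneg (p 0))]

/-- The points of the meridian segment of `y` — `(σ ϱ(y), 0, y₂)`, `σ ∈ [0, 1]` — are within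
`dist y x` of any axis point `x`. [folklore] -/
theorem dist_scaleFst_meridianPoint_le_of_axis {x : EuclideanSpace ℝ (Fin 3)}
    (hx : x 0 = 0 ∧ x 1 = 0) {σ : ℝ} (hσ : σ ∈ Icc (0 : ℝ) 1) (y : EuclideanSpace ℝ (Fin 3)) :
    dist (scaleFst σ (meridianPoint (meridian y))) x ≤ dist y x :=
  (dist_scaleFst_le_of_axis hx hσ _).trans (dist_meridianPoint_meridian_eq_of_axis hx y).le

/-! ### The boundary bound -/

section Boundary

variable {W : ℝ → EuclideanSpace ℝ (Fin 3) → EuclideanSpace ℝ (Fin 3)}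
  {c : EuclideanSpace ℝ (Fin 3)} {R t₀ T : ℝ}

/-- **Local bound for `f = ω_θ/ϱ` near a rim point, up to the top time.** If near `x` the
vorticity `curl (W t)` and the derivative of its `e₁`-component are bounded by `K` on
`B(x, r)` for the times `t ∈ [t₀, T)` with `T - r < t`, then `|f t| ≤ M` on a neighbourhood of
`x` for the same times: `M = K` if `x` is on the axis (meridian segments of nearby points stay in
`B(x, r)`, `abs_scalar_le_of_segment`), `M = 2K/ϱ(x)` otherwise (`|f| = ‖curl W‖/ϱ`,
`abs_scalar_eq_norm_curl_div`, and `ϱ ≥ ϱ(x)/2` nearby). [folklore] -/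
theorem exists_nhds_abs_scalar_le_of_local_bounds
    (hsmooth : ∀ τ ∈ Ico t₀ T, ContDiff ℝ ∞ (W τ))
    (hax : ∀ τ ∈ Ico t₀ T, IsAxisymmetric (W τ)) (hsw : ∀ τ ∈ Ico t₀ T, HasNoSwirl (W τ))
    (x : EuclideanSpace ℝ (Fin 3)) {r K : ℝ} (hr : 0 < r)
    (hK : ∀ t ∈ Ico t₀ T, T - r < t → ∀ y ∈ ball x r,
      ‖curl (W t) y‖ ≤ K ∧ ‖fderiv ℝ (fun z => curl (W t) z 1) y‖ ≤ K) :
    ∃ U ∈ 𝓝 x, ∃ M : ℝ, ∀ t ∈ Ico t₀ T, T - r < t → ∀ y ∈ U,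
      |hadamardQuotFst (fun z => curl (W t) z 1) y| ≤ M := by
  by_cases hρ : cylRadius x = 0
  · -- `x` on the axis: the meridian segments of the points of `B(x, r)` stay in `B(x, r)`
    have hx : x 0 = 0 ∧ x 1 = 0 := (cylRadius_eq_zero_iff x).1 hρ
    refine ⟨ball x r, ball_mem_nhds x hr, K, fun t ht htr y hy => ?_⟩
    refine abs_scalar_le_of_segment (hsmooth t ht) (hax t ht) (hsw t ht) y fun σ hσ => ?_
    refine (hK t ht htr _ ?_).2
    rw [mem_ball] at hy ⊢
    exact (dist_scaleFst_meridianPoint_le_of_axis hx hσ y).trans_lt hy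
  · -- `x` off the axis: `|f| = ‖curl W‖ / ϱ` with `ϱ ≥ ϱ(x)/2` on `B(x, ϱ(x)/2)`
    have hρ0 : 0 < cylRadius x := lt_of_le_of_ne (cylRadius_nonneg x) (Ne.symm hρ)
    refine ⟨ball x (min r (cylRadius x / 2)), ball_mem_nhds x (lt_min hr (half_pos hρ0)),
      2 * K / cylRadius x, fun t ht htr y hy => ?_⟩
    rw [mem_ball] at hy
    have hyr : y ∈ ball x r := mem_ball.2 (hy.trans_le (min_le_left _ _))
    have hyρ : cylRadius x / 2 ≤ cylRadius y := by
      have h1 := cylRadius_le_cylRadius_add_norm_sub y x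
      rw [← dist_eq_norm, dist_comm] at h1
      linarith [hy.trans_le (min_le_right _ _)]
    have hyρ0 : 0 < cylRadius y := lt_of_lt_of_le (half_pos hρ0) hyρ
    obtain ⟨hcurl, -⟩ := hK t ht htr y hyr
    have hK0 : 0 ≤ K := (norm_nonneg _).trans hcurl
    rw [abs_scalar_eq_norm_curl_div (hsmooth t ht) (hax t ht) (hsw t ht) hyρ0.ne',
      div_le_div_iff₀ hyρ0 hρ0]
    calc ‖curl (W t) y‖ * cylRadius x ≤ K * cylRadius x :=
          mul_le_mul_of_nonneg_right hcurl hρ0.le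
      _ = 2 * K * (cylRadius x / 2) := by ring
      _ ≤ 2 * K * cylRadius y := mul_le_mul_of_nonneg_left hyρ (by positivity)

/-- **The `η`-bound on the parabolic boundary of a cylinder reaching the top time** (the two
boundary hypotheses `hbot`, `hlat` of `noSwirl_abs_scalar_le_of_boundary`, uniformly in the
upper time `t₁ < T`). Let `W τ`, `τ ∈ [t₀, T)`, be smooth, axisymmetric and swirl free, with
uniform-in-`x` time moduli of all `x`-derivatives, let `c` be a point of the axis and `R > 0`,
and assume that every point `x` of the rim `∂B(c, R)` has a ball `B(x, r)` on which `curl (W t)`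
and `D(curl (W t))₁` are bounded for the times `T - r < t < T`. Then there is ONE `M` with
`|f t₀| ≤ M` on `B̄(c, R)` and `|f t| ≤ M` on `∂B(c, R)` for all `t ∈ [t₀, T)`,
`f t = hadamardQuotFst ((curl W t ·) ·)₁ = ω_θ/ϱ`. Proof: `f` is jointly continuous on
`[t₀, T) × ℝ³` (`scalar_family_continuousOn`), so bounded on the compact bottom and on every
compact part `[t₀, T - r⋆] × ∂B(c, R)` of the lateral boundary; a finite cover of the rim by
the neighbourhoods of `exists_nhds_abs_scalar_le_of_local_bounds` controls the times
`T - r⋆ < t < T`. [cite: Seregin2020, proof of Thm. 2.1, last paragraph (arXiv p. 8)] -/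
theorem noSwirl_scalar_boundary_bound :
    ∀ (W : ℝ → EuclideanSpace ℝ (Fin 3) → EuclideanSpace ℝ (Fin 3)) (c : EuclideanSpace ℝ (Fin 3))
      (R t₀ T : ℝ), t₀ < T →
      (∀ τ ∈ Ico t₀ T, ContDiff ℝ (⊤ : ℕ∞) (W τ)) →
      (∀ k : ℕ, ∀ τ ∈ Ico t₀ T, ∀ ε > 0, ∃ δ > 0, ∀ τ' ∈ Ico t₀ T, |τ' - τ| < δ → ∀ y,
        ‖iteratedFDeriv ℝ k (W τ') y - iteratedFDeriv ℝ k (W τ) y‖ ≤ ε) →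
      (∀ τ ∈ Ico t₀ T, IsAxisymmetric (W τ)) → (∀ τ ∈ Ico t₀ T, HasNoSwirl (W τ)) →
      (∀ x ∈ sphere c R, ∃ r > 0, ∃ K : ℝ, ∀ t ∈ Ico t₀ T, T - r < t → ∀ y ∈ ball x r,
        ‖curl (W t) y‖ ≤ K ∧ ‖fderiv ℝ (fun z => curl (W t) z 1) y‖ ≤ K) →
      ∃ M : ℝ, (∀ x ∈ closedBall c R, |hadamardQuotFst (fun z => curl (W t₀) z 1) x| ≤ M) ∧
        ∀ t ∈ Ico t₀ T, ∀ x ∈ sphere c R,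
          |hadamardQuotFst (fun z => curl (W t) z 1) x| ≤ M := by
  intro W c R t₀ T ht₀T hsmooth hunif hax hsw hrim
  -- joint continuity of `f`
  obtain ⟨hfsm, hfc, -, -, -⟩ := scalar_family_continuousOn (I := Ico t₀ T) hsmooth hunif
  have ht₀ : t₀ ∈ Ico t₀ T := ⟨le_rfl, ht₀T⟩
  -- ## the bottom
  obtain ⟨M₁, hM₁⟩ : ∃ M₁ : ℝ, ∀ x ∈ closedBall c R,
      |hadamardQuotFst (fun z => curl (W t₀) z 1) x| ≤ M₁ := by
    obtain ⟨C, hC⟩ := (isCompact_closedBall c R).exists_bound_of_continuousOn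
      ((hfsm t₀ ht₀).continuous.continuousOn)
    exact ⟨C, fun x hx => by rw [← Real.norm_eq_abs]; exact hC x hx⟩
  -- ## the rim, for times close to `T`: compactness of the sphere
  have hP : ∃ r > 0, ∃ M : ℝ, ∀ t ∈ Ico t₀ T, T - r < t → ∀ y ∈ sphere c R,
      |hadamardQuotFst (fun z => curl (W t) z 1) y| ≤ M := by
    refine (isCompact_sphere c R).induction_on
      (p := fun A => ∃ r > 0, ∃ M : ℝ, ∀ t ∈ Ico t₀ T, T - r < t → ∀ y ∈ A,
        |hadamardQuotFst (fun z => curl (W t) z 1) y| ≤ M) ?_ ?_ ?_ ?_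
    · exact ⟨1, one_pos, 0, fun t _ _ y hy => (notMem_empty y hy).elim⟩
    · rintro A B hAB ⟨r, hr, M, hM⟩
      exact ⟨r, hr, M, fun t ht htr y hy => hM t ht htr y (hAB hy)⟩
    · rintro A B ⟨r, hr, M, hM⟩ ⟨r', hr', M', hM'⟩
      refine ⟨min r r', lt_min hr hr', max M M', fun t ht htr y hy => ?_⟩
      rcases hy with hy | hy
      · exact (hM t ht (by linarith [min_le_left r r']) y hy).trans (le_max_left _ _)
      · exact (hM' t ht (by linarith [min_le_right r r']) y hy).trans (le_max_right _ _)
    · intro x hx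
      obtain ⟨r, hr, K, hK⟩ := hrim x hx
      obtain ⟨U, hU, M, hM⟩ := exists_nhds_abs_scalar_le_of_local_bounds hsmooth hax hsw x hr hK
      exact ⟨U, mem_nhdsWithin_of_mem_nhds hU, r, hr, M, hM⟩
  obtain ⟨r, hr, M₂, hM₂⟩ := hP
  -- ## the rim, for times `≤ T - r`: a compact part of the regularity region
  obtain ⟨M₃, hM₃⟩ : ∃ M₃ : ℝ, ∀ t ∈ Icc t₀ (T - r), ∀ y ∈ sphere c R,
      |hadamardQuotFst (fun z => curl (W t) z 1) y| ≤ M₃ := by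
    have hK : IsCompact (Icc t₀ (T - r) ×ˢ sphere c R) := isCompact_Icc.prod (isCompact_sphere c R)
    have hsub : Icc t₀ (T - r) ×ˢ sphere c R ⊆ Ico t₀ T ×ˢ (univ : Set (EuclideanSpace ℝ (Fin 3))) :=
      prod_mono (fun t ht => ⟨ht.1, by linarith [ht.2]⟩) (subset_univ _)
    obtain ⟨C, hC⟩ := hK.exists_bound_of_continuousOn (hfc.mono hsub)
    exact ⟨C, fun t ht y hy => by
      rw [← Real.norm_eq_abs]; exact hC (t, y) ⟨ht, hy⟩⟩
  -- ## assemble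
  refine ⟨max M₁ (max M₂ M₃), fun x hx => (hM₁ x hx).trans (le_max_left _ _), fun t ht x hx => ?_⟩
  rcases lt_or_ge (T - r) t with htr | htr
  · exact (hM₂ t ht htr x hx).trans ((le_max_left _ _).trans (le_max_right _ _))
  · exact (hM₃ t ⟨ht.1, htr⟩ x hx).trans ((le_max_right _ _).trans (le_max_right _ _))

end Boundary

end Summit.NavierStokesRegularity.NavierStokesRegularity.Theorems.AxisymmetricKatoGlobal.EulerScaling

end
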